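import Mathlib
import Literature.AlgebraicGeometry.Ramification.NormalSylowExtensions
import Literature.AlgebraicGeometry.Resolution.RegularLocalRingsNormal
import Summits.ResolutionOfSingularities.ResolutionOfSingularities.Theorems.WildQuotientsWildQuotientResolutionStubInertiaLe
import Summits.ResolutionOfSingularities.ResolutionOfSingularities.Theorems.WildQuotientsWildQuotientResolutionPhaseZeroNormalModel
import Summits.ResolutionOfSingularities.ResolutionOfSingularities.Theorems.WildQuotientsWildQuotientResolutionNormalToNormalization
import Summits.ResolutionOfSingularities.ResolutionOfSingularities.Theorems.WildQuotientsWildQuotientResolutionEquivariantPrincipalizationDefs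
import HarnessLib

/-!
# `stub_phaseZeroHighDim` from Abbes–Saito 2.22 and EQUIVARIANT PRINCIPALISATION on the regular `X′`
# (crux `WildQuotients.WildQuotientResolution`, line `Sketch`) — the residual (H3) reshaped to (H3*)

Crux stmt-ResolutionOfSingularities-15640 (`WildQuotientResolution`), registered stub `stub_phaseZeroHighDim`.
✓`FromNormalizationFinite.phaseZero_conclusion_of_equivariantRegularModels'` derives the VERBATIM conclusion of
the stub from (H1) Abbes–Saito 2011 Prop. 2.22 and (H3) «equivariant regular models of ALL equivariant proper
birational models of `X′`». This file replaces (H3) by the classical statement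
**(H3*) equivariant principalisation of `G`-stable ideal sheaves on the REGULAR `X′`**: for every ideal
sheaf `J` on `X′` with `ρ(g)^* J = J` whose co-support `V(J)` misses a non-empty open, there are an
integral REGULAR `Xr` with a `G`-action, a proper
birational equivariant `πr : Xr → X′` which is an isomorphism over every open missing `V(J)`, with
`J·𝒪_{Xr}` an effective Cartier divisor and a `G`-stable affine cover.

**Theorem** (`phaseZero_conclusion_of_equivariantPrincipalization`). (H1) ∧ (H3*) ⇒ the conclusion of
`stub_phaseZeroHighDim` (for its hypothesis list; `dim X′ ≥ 3` unused).

Proof: as in ✓`PhaseZeroNormalModel`, AS 2.22 gives a `W`-admissible blow-up `φ : Q′ → X′/G` and the lift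
`f′ : V = π⁻¹W → Q′` whose relative normalisation `Xs` has p-closed inertia. Principalise `J = I·𝒪_{X′}`
(the pulled-back centre, `G`-stable) by (H3*): `πr : Xr → X′`. The universal property of the blow-up
(✓`IsBlowup.lift`) gives `h : Xr → Q′`, `G`-invariant, with `j ≫ h = f′` for the open immersion
`j : V ↪ Xr` (`πr` is an isomorphism over `V`); `Xr` being regular hence NORMAL, it maps to `Xs` under `V`
and over `Q′` (✓`NormalToNormalization.exists_hom_normalization_of_normal`), EQUIVARIANTLY (maps into `Xs`
over `Q′` agreeing on the dense `V` coincide, Mathlib `ext_of_isDominant_of_isSeparated`); inertia only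
shrinks along equivariant maps (✓`InertiaLe.stub_inertia_le`), so `Xr` has p-closed inertia everywhere.

[OURS · crux stmt-ResolutionOfSingularities-15640 · helper toward `stub_phaseZeroHighDim` (conditional
reduction, NOT a proof of the stub: (H1) is a theorem in print, (H3*) = equivariant principalisation in
`dim ≥ 3`, char `p`, is open); counted 0; AI-level work, weaker than expert review.]
-/

-- single-problem summit: the doubled namespace component `ResolutionOfSingularities` is forced
set_option linter.dupNamespace false

noncomputable section

open CategoryTheory CategoryTheory.Limits AlgebraicGeometry TopologicalSpace
open Literature.AlgebraicGeometry.Ramification Literature.AlgebraicGeometry.RelativeSpec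
open Literature.AlgebraicGeometry.Resolution

namespace Summit.ResolutionOfSingularities.ResolutionOfSingularities.Theorems.WildQuotientResolution.PrincipalizationReduction

/-- **Equivariant form of ✓`NormalToNormalization.exists_hom_normalization_of_normal`.** If `G` acts on
`V`, `Z` with `j : V ↪ Z` equivariant and `h : Z → Q` invariant, the morphism `β : Z → Q^ν(f′)`
(`f′ = j ≫ h`) under `V` and over `Q` is `G`-equivariant for Abbes–Saito's induced action
`normalizationAction f′` on `Q^ν(f′)`: both `ρZ(g) ≫ β` and `β ≫ ρ^ν(g)` lie over `Q` (an affine, hence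
separated, structure map) and agree on the dense open `V` of the reduced `Z`. [cite: StacksProject, Tag 035I]
[cite: AbbesSaito2011, 2.4] -/
theorem exists_equivariant_hom_normalization_of_normal {G : Type*} [Group G] {V Z Q : Scheme.{0}}
    (j : V ⟶ Z) [IsOpenImmersion j] [QuasiCompact j] [IsIntegral V] [IsIntegral Z] [IsDominant j]
    (hZ : ∀ z : Z, IsIntegrallyClosed (Z.presheaf.stalk z)) (h : Z ⟶ Q) [QuasiCompact h]
    [QuasiSeparated h] (f' : V ⟶ Q) [QuasiCompact f'] [QuasiSeparated f'] (hjh : j ≫ h = f')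
    (ρV : G →* Aut V) (ρZ : G →* Aut Z) (hρV : ∀ g : G, (ρV g).hom ≫ f' = f')
    (hj : ∀ g : G, (ρV g).hom ≫ j = j ≫ (ρZ g).hom) (hh : ∀ g : G, (ρZ g).hom ≫ h = h) :
    ∃ β : Z ⟶ f'.normalization, j ≫ β = f'.toNormalization ∧ β ≫ f'.fromNormalization = h ∧
      ∀ g : G, (ρZ g).hom ≫ β = β ≫ (normalizationAction f' ρV hρV g).hom := by
  subst hjh
  obtain ⟨β, hβ1, hβ2⟩ := NormalToNormalization.exists_hom_normalization_of_normal j hZ h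
  refine ⟨β, hβ1, hβ2, fun g => ?_⟩
  refine ext_of_isDominant_of_isSeparated (j ≫ h).fromNormalization ?_ j ?_
  · rw [Category.assoc, hβ2, hh, Category.assoc, normalizationAction_hom_fromNormalization, hβ2]
  · rw [← Category.assoc, ← hj, Category.assoc, hβ1, ← Category.assoc, hβ1,
      toNormalization_normalizationAction_hom]

/-- Two morphisms into `Xr` which agree after `πr : Xr → X′` and land in an open `πr⁻¹V` over which `πr`
is an isomorphism coincide. [folklore] -/
theorem hom_eq_of_comp_eq_of_range_subset {T Xr X' : Scheme.{0}} (πr : Xr ⟶ X') (V : X'.Opens)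
    [IsIso (πr ∣_ V)] {a b : T ⟶ Xr} (hab : a ≫ πr = b ≫ πr)
    (ha : Set.range a.base ⊆ (πr ⁻¹ᵁ V : Set Xr)) (hb : Set.range b.base ⊆ (πr ⁻¹ᵁ V : Set Xr)) :
    a = b := by
  have hra : Set.range a.base ⊆ Set.range (πr ⁻¹ᵁ V).ι.base := by rwa [Scheme.Opens.range_ι]
  have hrb : Set.range b.base ⊆ Set.range (πr ⁻¹ᵁ V).ι.base := by rwa [Scheme.Opens.range_ι]
  have ea := IsOpenImmersion.lift_fac (πr ⁻¹ᵁ V).ι a hra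
  have eb := IsOpenImmersion.lift_fac (πr ⁻¹ᵁ V).ι b hrb
  have key : IsOpenImmersion.lift (πr ⁻¹ᵁ V).ι a hra = IsOpenImmersion.lift (πr ⁻¹ᵁ V).ι b hrb := by
    rw [← cancel_mono ((πr ∣_ V) ≫ V.ι), morphismRestrict_ι, ← Category.assoc, ← Category.assoc, ea,
      eb, hab]
  rw [← ea, ← eb, key]

/-- **`stub_phaseZeroHighDim`'s conclusion from (H1) Abbes–Saito 2011 Prop. 2.22 and (H3*) equivariant
principalisation of `G`-stable ideal sheaves on the regular `X′`** (see the module docstring). The conclusion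
is verbatim that of the registered stub; (H1) is a theorem in print, (H3*) is the open residual.
[cite: AbbesSaito2011, Prop. 2.22 (NS4), 2.4] [cite: GortzWedhorn2020, Def. 13.90] [cite: StacksProject, Tag 035I] -/
theorem phaseZero_conclusion_of_equivariantPrincipalization
    (hAS : AbbesSaito2011_inertiaNormalSylow_after_admissibleBlowup.{0})
    (p : ℕ) (hp : p.Prime) (k : Type) [Field k] [CharP k p]
    (X' X₁ : Scheme.{0}) (f : X₁ ⟶ Spec (.of k)) (q : X' ⟶ X₁) (G : Type) [Group G] [Finite G]
    (ρ : G →* Aut X') (hfaith : Function.Injective ρ)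
    [IsSeparated f] [LocallyOfFiniteType f] [QuasiCompact f] [IsIntegral X'] (hreg : Scheme.IsRegular X')
    [IsFinite q] (hρ : ∀ g : G, (ρ g).hom ≫ q = q)
    (hprinc : ∀ J : X'.IdealSheafData, (∀ g : G, J.comap (ρ g).hom = J) →
      (∃ U : X'.Opens, (U : Set X').Nonempty ∧ Disjoint (U : Set X') (J.support : Set X')) →
      ∃ (Xr : Scheme.{0}) (πr : Xr ⟶ X') (ρr : G →* Aut Xr), IsProper πr ∧ IsBirational πr ∧
        IsIntegral Xr ∧ Scheme.IsRegular Xr ∧ (∀ g : G, (ρr g).hom ≫ πr = πr ≫ (ρ g).hom) ∧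
        (∀ x : Xr, ∃ U : Xr.Opens, IsAffineOpen U ∧ x ∈ U ∧ ∀ g : G, (ρr g).hom ⁻¹ᵁ U = U) ∧
        IsEffectiveCartier (J.comap πr) ∧
        ∀ U : X'.Opens, Disjoint (U : Set X') (J.support : Set X') → IsIso (πr ∣_ U)) :
    ∃ (Xs : Scheme.{0}) (π : Xs ⟶ X') (ρs : G →* Aut Xs), IsProper π ∧ IsBirational π ∧
      IsIntegral Xs ∧ Scheme.IsRegular Xs ∧ (∀ g : G, (ρs g).hom ≫ π = π ≫ (ρ g).hom) ∧
      (∀ x : Xs, HasNormalSylow p (inertiaSubgroup ρs x)) ∧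
      ∀ x : Xs, ∃ U : Xs.Opens, IsAffineOpen U ∧ x ∈ U ∧ ∀ g : G, (ρs g).hom ⁻¹ᵁ U = U := by
  classical
  haveI : Fact p.Prime := ⟨hp⟩
  have hnorm : ∀ x : X', IsIntegrallyClosed (X'.presheaf.stalk x) := fun x =>
    haveI := hreg x; isIntegrallyClosed_of_isRegularLocalRing (X'.presheaf.stalk x)
  haveI : X₁.IsSeparated := ⟨by rw [← terminal.comp_from f]; infer_instance⟩
  haveI : X'.IsSeparated := ⟨by rw [← terminal.comp_from (q ≫ f)]; infer_instance⟩
  -- ### the glued quotient `X′/G` and Abbes–Saito's admissible blow-up (as in `PhaseZeroNormalModel`)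
  let ρk : ActionOver (q ≫ f) G := ⟨ρ, fun g => by rw [← Category.assoc, hρ g]⟩
  have hcov : ∀ x : X', ∃ O : ρk.StableAffineOpens, x ∈ O.1 :=
    QuotientPhaseZeroNormal.exists_stableAffineOpens_mem f q ρ hρ
  have hinj : Function.Injective ρk.aut := hfaith
  haveI : IsIntegral ρk.glued := ρk.isIntegral_glued hcov
  haveI : LocallyOfFiniteType (ρk.gluedDesc (q ≫ f) ρk.aut_comp) := ρk.locallyOfFiniteType_gluedDesc_base
  have hnormY : ∀ y : ρk.glued, IsIntegrallyClosed (ρk.glued.presheaf.stalk y) :=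
    QuotientModelNormal.isIntegrallyClosed_stalk_glued_of_stalk ρk hcov hnorm
  obtain ⟨W, hWd, hWet⟩ := exists_dense_etale_gluedMk_morphismRestrict ρk hcov hinj
  haveI := hWet
  obtain ⟨ρW, hρW, Q', φ, I, hb, hfg, hdisj, f', hqc, hqs, hρ', hf', hNS⟩ :=
    QuotientPhaseZeroNormal.exists_admissibleBlowup_glued_forall_hasNormalSylow hAS p (q ≫ f) ρk hinj
      hcov hnormY W hWd
  haveI := hqc
  haveI := hqs
  haveI : IsFinite (ρk.gluedMk hcov) := ρk.isFinite_gluedMk hcov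
  haveI : IsProper φ := IsBlowup.isProper_of_fg hfg hb
  -- the dense `G`-stable open `V = π⁻¹W`
  have hVne : ((ρk.gluedMk hcov ⁻¹ᵁ W : X'.Opens) : Set X').Nonempty := by
    obtain ⟨y, hy⟩ := hWd.nonempty
    obtain ⟨x, rfl⟩ := ρk.gluedMk_surjective hcov y
    exact ⟨x, hy⟩
  haveI : Nonempty ((ρk.gluedMk hcov ⁻¹ᵁ W : X'.Opens) : Scheme.{0}) := ⟨⟨_, hVne.some_mem⟩⟩
  haveI : IsIntegral ((ρk.gluedMk hcov ⁻¹ᵁ W : X'.Opens) : Scheme.{0}) :=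
    isIntegral_of_isOpenImmersion (ρk.gluedMk hcov ⁻¹ᵁ W).ι
  have hVst : ∀ (g : G) (x : X'), x ∈ (ρk.gluedMk hcov ⁻¹ᵁ W : X'.Opens) →
      (ρ g).hom.base x ∈ (ρk.gluedMk hcov ⁻¹ᵁ W : X'.Opens) := by
    intro g x hx
    change (ρk.gluedMk hcov).base (((ρk.aut g).hom).base x) ∈ W
    rw [← Scheme.Hom.comp_apply, ρk.aut_hom_gluedMk hcov g]
    exact hx
  -- ### (H3*): principalise the pulled-back centre `J = I·𝒪_{X′}`
  let J : X'.IdealSheafData := I.comap (ρk.gluedMk hcov)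
  have hJst : ∀ g : G, J.comap (ρ g).hom = J := fun g => by
    change (I.comap (ρk.gluedMk hcov)).comap (ρk.aut g).hom = I.comap (ρk.gluedMk hcov)
    rw [← Scheme.IdealSheafData.comap_comp, ρk.aut_hom_gluedMk hcov g]
  -- `V` misses `V(J)`
  have hVdisj : Disjoint ((ρk.gluedMk hcov ⁻¹ᵁ W : X'.Opens) : Set X') (J.support : Set X') := by
    have hsupp : (J.support : Set X') = (ρk.gluedMk hcov).base ⁻¹' (I.support : Set ρk.glued) := by
      change ((I.comap (ρk.gluedMk hcov)).support : Set X') = _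
      rw [Scheme.IdealSheafData.support_comap]
      rfl
    rw [hsupp]
    exact hdisj.preimage (ρk.gluedMk hcov).base
  obtain ⟨Xr, πr, ρr, hpropr, hbirr, hintr, hregr, hequivr, hcovr, hcart, hiso⟩ :=
    hprinc J hJst ⟨_, hVne, hVdisj⟩
  haveI := hpropr
  haveI := hintr
  have hZ : ∀ z : Xr, IsIntegrallyClosed (Xr.presheaf.stalk z) := fun z =>
    haveI := hregr z; isIntegrallyClosed_of_isRegularLocalRing (Xr.presheaf.stalk z)
  -- `Xr` is noetherian (so every morphism out of an open of `X′` or of `Xr` is quasi-compact)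
  haveI : IsLocallyNoetherian X' := LocallyOfFiniteType.isLocallyNoetherian (q ≫ f)
  haveI : CompactSpace X' := QuasiCompact.compactSpace_of_compactSpace (q ≫ f)
  haveI : IsNoetherian X' := {}
  -- ### the open immersion `j : V ↪ Xr` (`πr` is an isomorphism over `V`, which misses `V(J)`)
  haveI : IsIso (πr ∣_ (ρk.gluedMk hcov ⁻¹ᵁ W)) := hiso _ hVdisj
  let j : ((ρk.gluedMk hcov ⁻¹ᵁ W : X'.Opens) : Scheme.{0}) ⟶ Xr :=
    inv (πr ∣_ (ρk.gluedMk hcov ⁻¹ᵁ W)) ≫ (πr ⁻¹ᵁ (ρk.gluedMk hcov ⁻¹ᵁ W)).ι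
  have hjπ : j ≫ πr = (ρk.gluedMk hcov ⁻¹ᵁ W).ι := by
    simp only [j, Category.assoc, ← morphismRestrict_ι, IsIso.inv_hom_id_assoc]
  haveI : NoetherianSpace ((ρk.gluedMk hcov ⁻¹ᵁ W : X'.Opens) : Scheme.{0}) :=
    inferInstanceAs (NoetherianSpace ((ρk.gluedMk hcov ⁻¹ᵁ W : X'.Opens) : Set X'))
  have hjrange : Set.range j.base = ((πr ⁻¹ᵁ (ρk.gluedMk hcov ⁻¹ᵁ W) : Xr.Opens) : Set Xr) := by
    change Set.range ((inv (πr ∣_ (ρk.gluedMk hcov ⁻¹ᵁ W))) ≫ (πr ⁻¹ᵁ (ρk.gluedMk hcov ⁻¹ᵁ W)).ι).base = _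
    rw [Scheme.Hom.comp_base, TopCat.coe_comp, Set.range_comp,
      (ConcreteCategory.bijective_of_isIso (inv (πr ∣_ (ρk.gluedMk hcov ⁻¹ᵁ W))).base).2.range_eq,
      Set.image_univ, Scheme.Opens.range_ι]
  haveI : IsDominant j := by
    refine ⟨?_⟩
    rw [DenseRange, hjrange]
    have hne : ((πr ⁻¹ᵁ (ρk.gluedMk hcov ⁻¹ᵁ W) : Xr.Opens) : Set Xr).Nonempty := by
      rw [← hjrange]; exact Set.range_nonempty _
    exact (πr ⁻¹ᵁ (ρk.gluedMk hcov ⁻¹ᵁ W)).2.dense hne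
  -- `j` is `G`-equivariant
  have hjeq : ∀ g : G, (ρW g).hom ≫ j = j ≫ (ρr g).hom := by
    intro g
    refine hom_eq_of_comp_eq_of_range_subset πr (ρk.gluedMk hcov ⁻¹ᵁ W) ?_ ?_ ?_
    · rw [Category.assoc, hjπ, hρW g, Category.assoc, hequivr g, ← Category.assoc, hjπ]
    · rintro _ ⟨x, rfl⟩
      rw [Scheme.Hom.comp_base, TopCat.coe_comp, Function.comp_apply, ← hjrange]
      exact Set.mem_range_self _
    · rintro _ ⟨x, rfl⟩
      change πr.base (((ρr g).hom).base (j.base x)) ∈ (ρk.gluedMk hcov ⁻¹ᵁ W : X'.Opens)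
      rw [← Scheme.Hom.comp_apply, ← Scheme.Hom.comp_apply, hequivr g, ← Category.assoc, hjπ,
        Scheme.Hom.comp_apply]
      exact hVst g _ (by rw [Scheme.Opens.ι_apply]; exact x.2)
  -- ### `h : Xr → Q′` from the universal property of the blow-up, with `j ≫ h = f′`
  have hcart' : IsEffectiveCartier (I.comap (πr ≫ ρk.gluedMk hcov)) := by
    rwa [Scheme.IdealSheafData.comap_comp]
  let h : Xr ⟶ Q' := hb.lift (πr ≫ ρk.gluedMk hcov) hcart'
  have hVcart : IsEffectiveCartier (I.comap ((ρk.gluedMk hcov ⁻¹ᵁ W).ι ≫ ρk.gluedMk hcov)) := by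
    have hI : I.comap ((ρk.gluedMk hcov ⁻¹ᵁ W).ι ≫ ρk.gluedMk hcov) = ⊤ := by
      rw [← Scheme.IdealSheafData.support_eq_bot_iff, Scheme.IdealSheafData.support_comap]
      ext x
      simp only [Closeds.coe_preimage, Set.mem_preimage, Closeds.coe_bot, Set.mem_empty_iff_false,
        iff_false]
      intro hx
      refine Set.disjoint_left.mp hdisj (show (ρk.gluedMk hcov).base x.1 ∈ W from x.2) ?_
      simpa [Scheme.Hom.comp_base] using hx
    rw [hI]; exact isEffectiveCartier_top
  have hjh : j ≫ h = f' := by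
    refine hb.hom_ext ?_ ?_
    · rw [Category.assoc, hb.lift_comp, ← Category.assoc, hjπ]; exact hVcart
    · rw [Category.assoc, hb.lift_comp, ← Category.assoc, hjπ, hf', morphismRestrict_ι]
  have hh : ∀ g : G, (ρr g).hom ≫ h = h := by
    intro g
    refine hb.hom_ext ?_ ?_
    · rw [Category.assoc, hb.lift_comp, ← Category.assoc, hequivr g, Category.assoc,
        ρk.aut_hom_gluedMk hcov g]; exact hcart'
    · rw [Category.assoc, hb.lift_comp, ← Category.assoc, hequivr g, Category.assoc,
        ρk.aut_hom_gluedMk hcov g]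
  -- `h` is qcqs: `h ≫ φ = πr ≫ π` is, and `φ` is separated
  have hhφ : h ≫ φ = πr ≫ ρk.gluedMk hcov := hb.lift_comp _ _
  haveI : QuasiCompact (h ≫ φ) := by rw [hhφ]; infer_instance
  haveI : QuasiSeparated (h ≫ φ) := by rw [hhφ]; infer_instance
  haveI : QuasiCompact h := QuasiCompact.of_comp h φ
  haveI : QuasiSeparated h := QuasiSeparated.of_comp h φ
  -- ### the equivariant morphism `β : Xr → Xs = Q′^ν(f′)`, and inertia
  obtain ⟨β, -, -, hβeq⟩ := exists_equivariant_hom_normalization_of_normal j hZ h f' hjh ρW ρr hρ'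
    hjeq hh
  refine ⟨Xr, πr, ρr, hpropr, hbirr, hintr, hregr, hequivr, fun x => ?_, hcovr⟩
  exact ((hNS (β.base x)).subgroup ((inertiaSubgroup ρr x).subgroupOf
    (inertiaSubgroup (normalizationAction f' ρW hρ') (β.base x)))).of_mulEquiv
    (Subgroup.subgroupOfEquivOfLe (InertiaLe.stub_inertia_le ρr _ β hβeq x))

/-- **`stub_phaseZeroHighDim` ⟸ (H1) Abbes–Saito 2011 Prop. 2.22 ∧ (H3*) `EquivariantPrincipalization ρ`** — the same
theorem with the residual spelled by its name (✓`EquivariantPrincipalizationDefs`): the formal census of the stub is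
exactly these two named hypotheses. [cite: AbbesSaito2011, Prop. 2.22 (NS4)] [cite: Cutkosky2009, Thm. 1.3] -/
theorem phaseZero_conclusion_of_named
    (hAS : AbbesSaito2011_inertiaNormalSylow_after_admissibleBlowup.{0})
    (p : ℕ) (hp : p.Prime) (k : Type) [Field k] [CharP k p]
    (X' X₁ : Scheme.{0}) (f : X₁ ⟶ Spec (.of k)) (q : X' ⟶ X₁) (G : Type) [Group G] [Finite G]
    (ρ : G →* Aut X') (hfaith : Function.Injective ρ)
    [IsSeparated f] [LocallyOfFiniteType f] [QuasiCompact f] [IsIntegral X'] (hreg : Scheme.IsRegular X')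
    [IsFinite q] (hρ : ∀ g : G, (ρ g).hom ≫ q = q) (hprinc : EquivariantPrincipalization ρ) :
    ∃ (Xs : Scheme.{0}) (π : Xs ⟶ X') (ρs : G →* Aut Xs), IsProper π ∧ IsBirational π ∧
      IsIntegral Xs ∧ Scheme.IsRegular Xs ∧ (∀ g : G, (ρs g).hom ≫ π = π ≫ (ρ g).hom) ∧
      (∀ x : Xs, HasNormalSylow p (inertiaSubgroup ρs x)) ∧
      ∀ x : Xs, ∃ U : Xs.Opens, IsAffineOpen U ∧ x ∈ U ∧ ∀ g : G, (ρs g).hom ⁻¹ᵁ U = U :=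
  phaseZero_conclusion_of_equivariantPrincipalization hAS p hp k X' X₁ f q G ρ hfaith hreg hρ hprinc

end Summit.ResolutionOfSingularities.ResolutionOfSingularities.Theorems.WildQuotientResolution.PrincipalizationReduction

end
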